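import Literature.AnabelianGeometry.SemiGraphs.ArithDecompositionData
import HarnessLib

/-!
# [SemiAnbd] §5 p.65: first properties of the PRODUCED decomposition data (T54-0 companion, proof-only)

Mochizuki, *Semi-graphs of anabelioids*, Publ. RIMS **42** (2006), §5 p. 65 and Rmk 5.3.1
(kurims `paper:url-f33ace170ff4`). [cite: MochizukiSemiAnbd2006, §5, p. 65]

Proof-only companion of `ArithDecompositionData.lean` (abc-iut-w4-d053, sub-DAG
`plan/L3/SUBDAG-SemiAnbd-Thm54.md` row T54-0): the elementary group theory relating the produced
arithmetic decomposition groups `arithVertGp R ι v = C_{Gtp}(ι(Π^temp_{𝔾,v}))`,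
`arithBrGp R ι b` (commensurators, p. 65) to the geometric side `ι(Π^temp_𝔾) ⊆ Gtp`, under the
Prop 5.2 (iv) shape "`ι` injective with normal image (= `Ker(Π^temp_𝔊 ↠ Π_A)`)":

* `commensurator_map_inf_range` / `arithVertGp_inf_range` — `C_{Gtp}(ι H) ∩ ι(Π^temp_𝔾) = ι(C_{Π^temp_𝔾}(H))`
  (commensurability is preserved and reflected by injective homomorphisms); hence
  `arithVertGp_inf_range_of_commTerminal`: "`Π^temp_{𝔾,v} = Π^temp_{𝔊,v} ∩ Π^temp_𝔾`" (p. 65) holds for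
  the produced data EXACTLY WHEN the verticial subgroup is commensurably terminal in `Π^temp_𝔾`
  ([SemiAnbd] Cor 2.7 (i) + Prop 3.6 (iii), the bracket of p. 65 — an input here, by name);
* `commensurator_arithVertGp` — menu item H-CT of the T54 interface list (w4-d085): the produced
  vertex group is its own commensurator in `Gtp`, GIVEN geometric commensurable terminality;
* `arithBrGp_ne_arithVertGp_of` — menu item hγ: `Π^temp_{𝔊,b} ≠ Π^temp_{𝔊,v}`, GIVEN one element of
  `Π^temp_{𝔾,v}` that does not commensurate `Π^temp_{𝔾,b}` (tempered aloofness, [SemiAnbd] Def 2.4 (iv));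
* `inf_range_isGeomVerticial_of` — the verticial clause of Rmk 5.3.1 second sentence
  (`IntersectionWithGeometricStatement`, row T54-2) AT THE PRODUCED DATA, given geometric
  commensurable terminality and the chart-equivariance of `Gtp`-conjugation (Prop 3.6 (iv) at the
  arithmetic automorphisms — an explicit hypothesis, Def 5.1 (i)).

All hypotheses are explicit binders (no `def … : Prop`); nothing asserts a statement of the paper.
-/

namespace Literature.AnabelianGeometry.SemiGraphs

open CategoryTheory Topology
open scoped Pointwise

universe u u'

/-! ### Commensurators and injective homomorphisms -/

section Group

variable {G : Type*} [Group G] {G' : Type*} [Group G'] {f : G →* G'}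

/-- Commensurability is preserved and reflected by an injective homomorphism (relative indices are,
Mathlib `Subgroup.relIndex_map_map_of_injective`). [cite: MochizukiSemiAnbd2006, §0, p. 5] -/
theorem commensurable_map_iff_of_injective (hf : Function.Injective f) (H K : Subgroup G) :
    Subgroup.Commensurable (H.map f) (K.map f) ↔ Subgroup.Commensurable H K := by
  simp only [Subgroup.Commensurable, Subgroup.relIndex_map_map_of_injective _ _ hf]

/-- `f y` commensurates `f(H)` iff `y` commensurates `H` (for `f` injective).
[cite: MochizukiSemiAnbd2006, §0, p. 5] -/
theorem map_mem_commensurator_map_iff (hf : Function.Injective f) (H : Subgroup G) (y : G) :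
    f y ∈ Subgroup.Commensurable.commensurator (H.map f) ↔
      y ∈ Subgroup.Commensurable.commensurator H := by
  rw [Subgroup.Commensurable.commensurator_mem_iff, Subgroup.Commensurable.commensurator_mem_iff,
    ← map_conjAct_smul, commensurable_map_iff_of_injective hf]

/-- `C_{G'}(f H) ∩ f(G) = f(C_G(H))` for `f` injective: the commensurator seen inside the image.
[cite: MochizukiSemiAnbd2006, §0, p. 5] -/
theorem commensurator_map_inf_range (hf : Function.Injective f) (H : Subgroup G) :
    Subgroup.Commensurable.commensurator (H.map f) ⊓ f.range =
      (Subgroup.Commensurable.commensurator H).map f := by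
  ext x
  constructor
  · rintro ⟨hx, y, rfl⟩
    exact ⟨y, (map_mem_commensurator_map_iff hf H y).mp hx, rfl⟩
  · rintro ⟨y, hy, rfl⟩
    exact ⟨(map_mem_commensurator_map_iff hf H y).mpr hy, y, rfl⟩

end Group

namespace ProfiniteSemiGraph

variable {𝒢 : ProfiniteSemiGraph.{u}} {c : TemperedPiChart 𝒢} {Gtp : Type u'} [Group Gtp]

/-! ### `Π^temp_{𝔊,v} ∩ Π^temp_𝔾` -/

/-- `Π^temp_{𝔊,v} ∩ ι(Π^temp_𝔾) = ι(C_{Π^temp_𝔾}(Π^temp_{𝔾,v}))` for the produced vertex group and `ι`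
injective (Prop 5.2 (iv)). [cite: MochizukiSemiAnbd2006, §5, p. 65] -/
theorem arithVertGp_inf_range (R : ChartRepresentatives c) {ι : c.G →* Gtp}
    (hι : Function.Injective ι) (v : 𝒢.graph.Vertex) :
    arithVertGp R ι v ⊓ ι.range = (Subgroup.Commensurable.commensurator (R.Hv v)).map ι :=
  commensurator_map_inf_range hι _

/-- **"`Π^temp_{𝔾,v} = Π^temp_{𝔊,v} ∩ Π^temp_𝔾`"** (p. 65) for the produced data, GIVEN that the verticial
subgroup is commensurably terminal in `Π^temp_𝔾` (the bracket "[Cor 2.7 (i), (iii); Prop 3.6 (iii)]"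
of p. 65 — an input, by name). [cite: MochizukiSemiAnbd2006, §5, p. 65] -/
theorem arithVertGp_inf_range_of_commTerminal (R : ChartRepresentatives c) {ι : c.G →* Gtp}
    (hι : Function.Injective ι) {v : 𝒢.graph.Vertex}
    (hct : Subgroup.Commensurable.commensurator (R.Hv v) = R.Hv v) :
    arithVertGp R ι v ⊓ ι.range = (R.Hv v).map ι := by
  rw [arithVertGp_inf_range R hι v, hct]

/-! ### H-CT: the produced vertex group is commensurably terminal -/

/-- **Menu item H-CT** (T54 interface list): `C_{Gtp}(Π^temp_{𝔊,v}) = Π^temp_{𝔊,v}` for the produced vertex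
group — GIVEN geometric commensurable terminality `C_{Π^temp_𝔾}(Π^temp_{𝔾,v}) = Π^temp_{𝔾,v}` (Cor 2.7 (i)
transferred by Prop 3.6 (iii)) and normality of `ι(Π^temp_𝔾) ⊴ Gtp` (it is `Ker(Π^temp_𝔊 ↠ Π_A)`,
Prop 5.2 (iv)).  Proof: if `x` commensurates `A = C(ιH)`, intersect with the normal subgroup
`N = ι(Π^temp_𝔾)`: `x (A ∩ N) x⁻¹ = xAx⁻¹ ∩ N` is commensurable with `A ∩ N = ιH`, so `x ∈ C(ιH) = A`.
[cite: MochizukiSemiAnbd2006, Thm 5.4 (i), p. 66] -/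
theorem commensurator_arithVertGp (R : ChartRepresentatives c) {ι : c.G →* Gtp}
    (hι : Function.Injective ι) (hN : ι.range.Normal) {v : 𝒢.graph.Vertex}
    (hct : Subgroup.Commensurable.commensurator (R.Hv v) = R.Hv v) :
    Subgroup.Commensurable.commensurator (arithVertGp R ι v) = arithVertGp R ι v := by
  refine le_antisymm ?_ (le_commensurator_self _)
  intro x hx
  have hAN : arithVertGp R ι v ⊓ ι.range = (R.Hv v).map ι :=
    arithVertGp_inf_range_of_commTerminal R hι hct
  rw [Subgroup.Commensurable.commensurator_mem_iff] at hx
  -- commensurability passes to intersections with the fixed subgroup `N = ι(Π^temp_𝔾)`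
  -- (`[B ∩ N : A ∩ B ∩ N] ≤ [B : A ∩ B]`; cf. the tree's `commensurable_inf_right`)
  have key : ∀ {A B : Subgroup Gtp}, A.relIndex B ≠ 0 →
      (A ⊓ ι.range).relIndex (B ⊓ ι.range) ≠ 0 := by
    intro A B hAB
    refine Subgroup.relIndex_inf_ne_zero ?_ ?_
    · exact fun h0 => hAB (Subgroup.relIndex_eq_zero_of_le_right inf_le_left h0)
    · rw [Subgroup.relIndex_eq_one.mpr inf_le_right]
      exact one_ne_zero
  have h2 : Subgroup.Commensurable (ConjAct.toConjAct x • arithVertGp R ι v ⊓ ι.range)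
      (arithVertGp R ι v ⊓ ι.range) := ⟨key hx.1, key hx.2⟩
  have hN' : ConjAct.toConjAct x • ι.range = ι.range := hN.conjAct _
  nth_rewrite 1 [← hN'] at h2
  rw [← Subgroup.smul_inf, hAN] at h2
  -- `h2 : Commensurable (x • ιH) ιH`
  exact (Subgroup.Commensurable.commensurator_mem_iff _ _).mpr h2

/-! ### hγ: branch groups are proper in vertex groups -/

/-- **Menu item hγ** (T54 interface list): `Π^temp_{𝔊,b} ≠ Π^temp_{𝔊,v}` for a branch `b` abutting to `v`,
GIVEN an element of the chosen `Π^temp_{𝔾,v}` that does NOT commensurate the chosen `Π^temp_{𝔾,b}` (tempered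
aloofness / estrangement at `b`, [SemiAnbd] Def 2.4 (iv) p. 26 transported into `π₁^temp(G)` — an
explicit input) and `ι` injective: otherwise `ι(Π^temp_{𝔾,v}) ⊆ Π^temp_{𝔊,v} = Π^temp_{𝔊,b} ⊆ C(ι Π^temp_{𝔾,b})`,
so every element of `Π^temp_{𝔾,v}` would commensurate `Π^temp_{𝔾,b}`.
[cite: MochizukiSemiAnbd2006, Def 5.3 (ii), p. 65] -/
theorem arithBrGp_ne_arithVertGp_of (R : ChartRepresentatives c) {ι : c.G →* Gtp}
    (hι : Function.Injective ι) {b : 𝒢.graph.Branch} {v : 𝒢.graph.Vertex}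
    (h : 𝒢.graph.abuts b = some v)
    (hx : ∃ x ∈ R.Hv v, x ∉ Subgroup.Commensurable.commensurator (R.Hb b)) :
    arithBrGp R ι b ≠ arithVertGp R ι v := by
  obtain ⟨x, hxv, hxb⟩ := hx
  intro heq
  apply hxb
  have h1 : ι x ∈ arithVertGp R ι v := map_le_arithVertGp R ι v ⟨x, hxv, rfl⟩
  rw [← heq, arithBrGp_of_abuts R ι h] at h1
  exact (map_mem_commensurator_map_iff hι (R.Hb b) x).mp h1.2

/-! ### The verticial clause of Rmk 5.3.1 (second sentence) at the produced data -/

/-- Conjugation by `g ∈ Gtp` commutes with intersecting with the normal subgroup `ι(Π^temp_𝔾)`.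
[cite: MochizukiSemiAnbd2006, §0, p. 5] -/
theorem conjSubgroup_inf_range {ι : c.G →* Gtp} (hN : ι.range.Normal) (g : Gtp) (A : Subgroup Gtp) :
    conjSubgroup g A ⊓ ι.range = conjSubgroup g (A ⊓ ι.range) := by
  change ConjAct.toConjAct g • A ⊓ ι.range = ConjAct.toConjAct g • (A ⊓ ι.range)
  rw [Subgroup.smul_inf, hN.conjAct]

/-- **Rmk 5.3.1, second sentence, verticial clause, AT THE PRODUCED DATA** (row T54-2's
`IntersectionWithGeometricStatement`, verticial half, for `D = decompositionDataOfChart R ι` and an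
augmentation with `Ker aug = ι(Π^temp_𝔾)`): "the intersection with `Π^temp_𝔾` of a verticial subgroup of
`Π^temp_𝔊` is a verticial subgroup of `Π^temp_𝔾` in the sense of Theorem 3.7" — here: it is `ι(H')` for a
§3 verticial subgroup `H'` at some vertex.  GIVEN (i) geometric commensurable terminality of all
verticial subgroups (Cor 2.7 (i) + Prop 3.6 (iii)) and (ii) chart-equivariance of `Gtp`-conjugation:
conjugation by any `g ∈ Gtp` carries the image of a verticial subgroup to the image of a verticial
subgroup (Prop 3.6 (iv) applied to the automorphism `ρ(aug g)` of `𝔊`, Def 5.1 (i)) — both explicit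
inputs. [cite: MochizukiSemiAnbd2006, Rmk 5.3.1, p. 65] -/
theorem inf_ker_isGeomVerticial_of (R : ChartRepresentatives c) {ι : c.G →* Gtp}
    (hι : Function.Injective ι) (hN : ι.range.Normal) {PA : Type*} [Group PA] {aug : Gtp →* PA}
    (hker : aug.ker = ι.range)
    (hct : ∀ (w : 𝒢.graph.Vertex) (H : Subgroup c.G), H ∈ verticialSubgroups c w →
      Subgroup.Commensurable.commensurator H = H)
    (hequiv : ∀ (g : Gtp) (w : 𝒢.graph.Vertex) (H : Subgroup c.G), H ∈ verticialSubgroups c w →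
      ∃ (w' : 𝒢.graph.Vertex) (H' : Subgroup c.G), H' ∈ verticialSubgroups c w' ∧
        conjSubgroup g (H.map ι) = H'.map ι)
    (K : Subgroup Gtp) (hK : IsVerticial (decompositionDataOfChart R ι) K) :
    ∃ (w : 𝒢.graph.Vertex) (H' : Subgroup c.G), H' ∈ verticialSubgroups c w ∧ K ⊓ aug.ker = H'.map ι := by
  obtain ⟨v, g, rfl⟩ := hK
  rw [hker, conjSubgroup_inf_range hN, decompositionDataOfChart_vertGp,
    arithVertGp_inf_range_of_commTerminal R hι (hct v _ (R.Hv_mem v))]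
  obtain ⟨w', H', hH', hconj⟩ := hequiv g v (R.Hv v) (R.Hv_mem v)
  exact ⟨w', H', hH', hconj⟩

/-! ### Menu items hcomm_v / hcomm_b (T54 interface list v2) at the produced data -/

/-- **Menu item hcomm_v**: "the commensurator of the geometric part recovers the vertex group",
`C_{Gtp}(Π^temp_{𝔊,v} ∩ Ker aug) = Π^temp_{𝔊,v}`, for the produced data — immediate from the definition
(`Π^temp_{𝔊,v} := C(ι Π^temp_{𝔾,v})`) once `Π^temp_{𝔊,v} ∩ Ker aug = ι Π^temp_{𝔾,v}`, i.e. GIVEN geometric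
commensurable terminality and `Ker aug = ι(Π^temp_𝔾)` (Prop 5.2 (iv)). [cite: MochizukiSemiAnbd2006, §5, p. 65] -/
theorem commensurator_arithVertGp_inf_ker (R : ChartRepresentatives c) {ι : c.G →* Gtp}
    (hι : Function.Injective ι) {PA : Type*} [Group PA] {aug : Gtp →* PA} (hker : aug.ker = ι.range)
    {v : 𝒢.graph.Vertex} (hct : Subgroup.Commensurable.commensurator (R.Hv v) = R.Hv v) :
    Subgroup.Commensurable.commensurator (arithVertGp R ι v ⊓ aug.ker) = arithVertGp R ι v := by
  rw [hker, arithVertGp_inf_range_of_commTerminal R hι hct]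
  rfl

/-- The geometric part of the produced BRANCH group: `Π^temp_{𝔊,b} ∩ ι(Π^temp_𝔾) = ι(Π^temp_{𝔾,v} ∩ C(Π^temp_{𝔾,b}))`
for `b` abutting to `v`, GIVEN commensurable terminality of the vertex group.
[cite: MochizukiSemiAnbd2006, §5, p. 65] -/
theorem arithBrGp_inf_range (R : ChartRepresentatives c) {ι : c.G →* Gtp} (hι : Function.Injective ι)
    {b : 𝒢.graph.Branch} {v : 𝒢.graph.Vertex} (h : 𝒢.graph.abuts b = some v)
    (hct : Subgroup.Commensurable.commensurator (R.Hv v) = R.Hv v) :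
    arithBrGp R ι b ⊓ ι.range =
      (R.Hv v ⊓ Subgroup.Commensurable.commensurator (R.Hb b)).map ι := by
  rw [arithBrGp_of_abuts R ι h, inf_assoc, commensurator_map_inf_range hι]
  apply le_antisymm
  · rintro x ⟨hxv, y, hy, rfl⟩
    have hxr : ι y ∈ arithVertGp R ι v ⊓ ι.range := ⟨hxv, y, rfl⟩
    rw [arithVertGp_inf_range_of_commTerminal R hι hct] at hxr
    obtain ⟨y', hy', hyy⟩ := hxr
    obtain rfl := hι hyy
    exact ⟨y', ⟨hy', hy⟩, rfl⟩
  · rintro x ⟨y, ⟨hyv, hyb⟩, rfl⟩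
    exact ⟨map_le_arithVertGp R ι v ⟨y, hyv, rfl⟩, y, hyb, rfl⟩

/-- **Menu item hcomm_b is NOT definitional** (honest): for `b` abutting to `v`, GIVEN the geometric
inputs (commensurable terminality of `Π^temp_{𝔾,v}`; `Π^temp_{𝔾,v} ∩ C(Π^temp_{𝔾,b}) = Π^temp_{𝔾,b}`, i.e. tempered
estrangement at `b`), the clause `C_{Gtp}(Π^temp_{𝔊,b} ∩ Ker aug) = Π^temp_{𝔊,b}` holds IF the commensurator
of the branch group lies in the vertex group, `C(ι Π^temp_{𝔾,b}) ≤ Π^temp_{𝔊,v}` — "an element commensurating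
the edge group commensurates the vertex group", the no-branch-switching content (a pro-tree edge
stabiliser fixes its end-points), an `ArithLevelData`-level input, NOT a producer definition.
[cite: MochizukiSemiAnbd2006, §5, p. 65] -/
theorem commensurator_arithBrGp_inf_ker_of (R : ChartRepresentatives c) {ι : c.G →* Gtp}
    (hι : Function.Injective ι) {PA : Type*} [Group PA] {aug : Gtp →* PA} (hker : aug.ker = ι.range)
    {b : 𝒢.graph.Branch} {v : 𝒢.graph.Vertex} (h : 𝒢.graph.abuts b = some v)
    (hct : Subgroup.Commensurable.commensurator (R.Hv v) = R.Hv v)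
    (hrel : R.Hv v ⊓ Subgroup.Commensurable.commensurator (R.Hb b) = R.Hb b)
    (hsub : Subgroup.Commensurable.commensurator ((R.Hb b).map ι) ≤ arithVertGp R ι v) :
    Subgroup.Commensurable.commensurator (arithBrGp R ι b ⊓ aug.ker) = arithBrGp R ι b := by
  rw [hker, arithBrGp_inf_range R hι h hct, hrel, arithBrGp_of_abuts R ι h]
  exact (inf_eq_right.mpr hsub).symm

end ProfiniteSemiGraph

end Literature.AnabelianGeometry.SemiGraphs
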